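import Summits.Ventures.Crystal3D.Theorems.StickyWulffConstantGenericWallFloorCoaxialCriterion
import Summits.Ventures.Crystal3D.Theorems.StickyWulffConstantCoaxialWallLawFrame
import HarnessLib

/-!
# Co-axiality is exactly «a common linear frame up to the mirror twin» (crux `GenericWallFloor`,
# line `WallLedgerG`; also the `CoAx` clause of `CoaxialWallLaw`, `PolycrystalWulffBound`, `TextureLiminf`)

HONEST FRAMING. Part of the venture `Summits/Ventures/Crystal3D` (cell `crystal3d-full`), helper
`--supports` the crux `GenericWallFloor` (stmt-Ventures-19480) of `route-Ventures-StickyWulffConstant`,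
registered line `WallLedgerG` (planner cf-p1 gen 16), stub `stub_twoSlabAdhesion : TwoSlabAdhesion`.
The wall cruxes quantify over pairs of moved fcc lattices `Aᵢ·Λ₀ + tᵢ` through the clause

  `CoAx := ∃ L s₁ s₂ σ σ', IsHaggSeq σ ∧ IsHaggSeq σ' ∧ A₁·Λ₀ + t₁ ⊆ L·B(σ) + s₁ ∧ A₂·Λ₀ + t₂ ⊆ L·B(σ') + s₂`.

`…CoaxialCriterion` proved the convenient SUFFICIENT condition (a common linear frame `L` with
`Aᵢ·Λ₀ ∈ {L·Λ₀, L·Λ₀⁻}`).  Here the condition is shown NECESSARY as well, so that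
**`coaxial_iff_common_frame`** characterises the clause: a containment `A·Λ₀ + t ⊆ L·B(σ) + s` is an
equality (`movedFcc_eq_barlowImage`, seat 19481-p1), the stacking `B(σ)` is then a translate of a
lattice through the origin, hence a lattice, hence `σ` is CONSTANT (the barrier theorem
`HcpNotBravaisNarrow_holds`: only the two fcc words code Bravais lattices), i.e. `B(σ) ∈ {Λ₀, Λ₀⁻}` and
`A·Λ₀ = L·B(σ 0)` (`linear_image_eq_frame_of_subset`).  Consequences: `CoAx` does not depend on the
translations (`coaxial_iff_coaxial_zero`), and a co-axial pair of DIFFERENT linear lattices is a mirror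
twin pair in the common frame (`twin_of_coaxial_of_ne`).

WHAT THIS IS NOT: uniqueness of the common axis; nothing about walls; rung F-C1 not moved.
-/

noncomputable section

namespace Summit.Ventures.Crystal3D.Theorems

open Literature.MathematicalPhysics.StatisticalMechanics
open Literature.Barriers.AtomisticToContinuum (barlowAddSubgroupOfConst HcpNotBravaisNarrow_holds)

/-- **A Barlow frame containing a moved fcc lattice is an fcc frame of it.**  If
`A·Λ₀ + t ⊆ L·B(σ) + s` (`σ` Hägg) then `σ` is constant and the LINEAR lattice is `A·Λ₀ = L·B(σ 0)`;
in particular `A·Λ₀ ∈ {L·Λ₀, L·Λ₀⁻}`. -/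
theorem linear_image_eq_frame_of_subset
    (A L : EuclideanSpace ℝ (Fin 3) ≃ₗᵢ[ℝ] EuclideanSpace ℝ (Fin 3)) (t s : EuclideanSpace ℝ (Fin 3))
    {σ : ℤ → ℤ} (hσ : IsHaggSeq σ)
    (hsub : (fun p => A p + t) '' fccStacking 1 (Real.sqrt (2 / 3)) ⊆
      (fun p => L p + s) '' barlowStacking 1 (Real.sqrt (2 / 3)) σ) :
    (∀ m, σ m = σ 0) ∧
      A '' fccStacking 1 (Real.sqrt (2 / 3)) = L '' barlowStacking 1 (Real.sqrt (2 / 3)) (fun _ : ℤ => σ 0) := by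
  classical
  have heq := movedFcc_eq_barlowImage A t L s hσ hsub
  -- pull back by `L`: `B(σ) = M·Λ₀ + c` with `M = L⁻¹A`, `c = L⁻¹(t − s)`
  set M : EuclideanSpace ℝ (Fin 3) ≃ₗᵢ[ℝ] EuclideanSpace ℝ (Fin 3) := A.trans L.symm with hM
  have hMw : ∀ x, M x = L.symm (A x) := fun x => rfl
  set c : EuclideanSpace ℝ (Fin 3) := L.symm (t - s) with hc
  have hB : barlowStacking 1 (Real.sqrt (2 / 3)) σ = (fun p => M p + c) '' fccStacking 1 (Real.sqrt (2 / 3)) := by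
    ext q
    constructor
    · intro hq
      have : L q + s ∈ (fun p => A p + t) '' fccStacking 1 (Real.sqrt (2 / 3)) := by
        rw [heq]; exact ⟨q, hq, rfl⟩
      obtain ⟨p, hp, e⟩ := this
      refine ⟨p, hp, ?_⟩
      apply L.injective
      simp only [hMw, hc, map_add, LinearIsometryEquiv.apply_symm_apply]
      simp only at e
      rw [add_sub, e, add_sub_cancel_right]
    · rintro ⟨p, hp, rfl⟩
      have : A p + t ∈ (fun p => L p + s) '' barlowStacking 1 (Real.sqrt (2 / 3)) σ := by
        rw [← heq]; exact ⟨p, hp, rfl⟩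
      obtain ⟨q, hq, e⟩ := this
      have : q = M p + c := by
        apply L.injective
        simp only [hMw, hc, map_add, LinearIsometryEquiv.apply_symm_apply]
        simp only at e
        rw [add_sub, ← e, add_sub_cancel_right]
      show M p + c ∈ _
      rw [← this]; exact hq
  -- the translation is itself a lattice vector (`0 ∈ B(σ)`), so `B(σ) = M·Λ₀`
  set G₁ : AddSubgroup (EuclideanSpace ℝ (Fin 3)) :=
    barlowAddSubgroupOfConst 1 (Real.sqrt (2 / 3)) constHagg (fun _ => rfl) with hG₁
  have hG₁mem : ∀ w, w ∈ G₁ ↔ w ∈ fccStacking 1 (Real.sqrt (2 / 3)) := fun w => Iff.rfl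
  have h0 : (0 : EuclideanSpace ℝ (Fin 3)) ∈ barlowStacking 1 (Real.sqrt (2 / 3)) σ :=
    ⟨0, 0, 0, by ext l; fin_cases l <;> simp⟩
  rw [hB] at h0
  obtain ⟨p₀, hp₀, e0⟩ := h0
  have e0' : M p₀ + c = 0 := e0
  have hc' : c = M (-p₀) := by rw [map_neg]; exact eq_neg_of_add_eq_zero_right e0'
  have hBM : barlowStacking 1 (Real.sqrt (2 / 3)) σ = M '' fccStacking 1 (Real.sqrt (2 / 3)) := by
    rw [hB]
    ext q
    constructor
    · rintro ⟨p, hp, rfl⟩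
      refine ⟨p - p₀, (hG₁mem _).1 (G₁.sub_mem ((hG₁mem _).2 hp) ((hG₁mem _).2 hp₀)), ?_⟩
      simp only [map_sub, hc', map_neg]; abel
    · rintro ⟨p, hp, rfl⟩
      refine ⟨p + p₀, (hG₁mem _).1 (G₁.add_mem ((hG₁mem _).2 hp) ((hG₁mem _).2 hp₀)), ?_⟩
      simp only [map_add, hc', map_neg]; abel
  -- hence `B(σ)` is a subgroup and `σ` is constant
  have hconst : ∀ m, σ m = σ 0 := by
    have hex : ∃ L' : AddSubgroup (EuclideanSpace ℝ (Fin 3)),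
        (L' : Set (EuclideanSpace ℝ (Fin 3))) = barlowStacking 1 (Real.sqrt (2 / 3)) σ := by
      refine ⟨G₁.map M.toLinearEquiv.toAddMonoidHom, ?_⟩
      rw [AddSubgroup.coe_map, hBM]
      rfl
    exact ((HcpNotBravaisNarrow_holds 1 (Real.sqrt (2 / 3)) one_ne_zero
      (Real.sqrt_ne_zero'.2 (by norm_num)) σ hσ).1 hex)
  refine ⟨hconst, ?_⟩
  have hσfun : σ = fun _ : ℤ => σ 0 := funext hconst
  have hA : A '' fccStacking 1 (Real.sqrt (2 / 3)) = L '' (M '' fccStacking 1 (Real.sqrt (2 / 3))) := by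
    rw [Set.image_image]
    exact Set.image_congr fun x _ => by rw [hMw, LinearIsometryEquiv.apply_symm_apply]
  rw [hA, ← hBM]
  exact congrArg _ (by rw [hσfun])

/-- **Co-axial ⟺ a common linear frame up to the mirror twin.**  The `CoAx` clause of the wall
cruxes holds for the pair `(A₁·Λ₀ + t₁, A₂·Λ₀ + t₂)` iff ONE linear isometry `L` has
`Aᵢ·Λ₀ ∈ {L·Λ₀, L·Λ₀⁻}` for `i = 1, 2` (`Λ₀⁻ = B(−1)`). -/
theorem coaxial_iff_common_frame
    (A₁ A₂ : EuclideanSpace ℝ (Fin 3) ≃ₗᵢ[ℝ] EuclideanSpace ℝ (Fin 3)) (t₁ t₂ : EuclideanSpace ℝ (Fin 3)) :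
    (∃ (L' : EuclideanSpace ℝ (Fin 3) ≃ₗᵢ[ℝ] EuclideanSpace ℝ (Fin 3))
      (s₁ s₂ : EuclideanSpace ℝ (Fin 3)) (σ σ' : ℤ → ℤ), IsHaggSeq σ ∧ IsHaggSeq σ' ∧
      (fun p => A₁ p + t₁) '' fccStacking 1 (Real.sqrt (2 / 3)) ⊆
        (fun p => L' p + s₁) '' barlowStacking 1 (Real.sqrt (2 / 3)) σ ∧
      (fun p => A₂ p + t₂) '' fccStacking 1 (Real.sqrt (2 / 3)) ⊆
        (fun p => L' p + s₂) '' barlowStacking 1 (Real.sqrt (2 / 3)) σ') ↔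
    ∃ L : EuclideanSpace ℝ (Fin 3) ≃ₗᵢ[ℝ] EuclideanSpace ℝ (Fin 3),
      (A₁ '' fccStacking 1 (Real.sqrt (2 / 3)) = L '' fccStacking 1 (Real.sqrt (2 / 3)) ∨
        A₁ '' fccStacking 1 (Real.sqrt (2 / 3)) =
          L '' barlowStacking 1 (Real.sqrt (2 / 3)) (fun _ : ℤ => (-1 : ℤ))) ∧
      (A₂ '' fccStacking 1 (Real.sqrt (2 / 3)) = L '' fccStacking 1 (Real.sqrt (2 / 3)) ∨
        A₂ '' fccStacking 1 (Real.sqrt (2 / 3)) =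
          L '' barlowStacking 1 (Real.sqrt (2 / 3)) (fun _ : ℤ => (-1 : ℤ))) := by
  constructor
  · rintro ⟨L, s₁, s₂, σ, σ', hσ, hσ', h₁, h₂⟩
    obtain ⟨-, e₁⟩ := linear_image_eq_frame_of_subset A₁ L t₁ s₁ hσ h₁
    obtain ⟨-, e₂⟩ := linear_image_eq_frame_of_subset A₂ L t₂ s₂ hσ' h₂
    have hfcc : fccStacking 1 (Real.sqrt (2 / 3)) = barlowStacking 1 (Real.sqrt (2 / 3)) (fun _ : ℤ => (1 : ℤ)) :=
      rfl
    refine ⟨L, ?_, ?_⟩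
    · rcases hσ 0 with h | h
      · left; rw [e₁, h, hfcc]
      · right; rw [e₁, h]
    · rcases hσ' 0 with h | h
      · left; rw [e₂, h, hfcc]
      · right; rw [e₂, h]
  · rintro ⟨L, h₁, h₂⟩
    exact coaxial_of_common_frame A₁ A₂ L t₁ t₂ h₁ h₂

/-- **Co-axiality does not see the translations.** -/
theorem coaxial_translate
    (A₁ A₂ : EuclideanSpace ℝ (Fin 3) ≃ₗᵢ[ℝ] EuclideanSpace ℝ (Fin 3))
    (t₁ t₂ t₁' t₂' : EuclideanSpace ℝ (Fin 3))
    (h : ∃ (L' : EuclideanSpace ℝ (Fin 3) ≃ₗᵢ[ℝ] EuclideanSpace ℝ (Fin 3))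
      (s₁ s₂ : EuclideanSpace ℝ (Fin 3)) (σ σ' : ℤ → ℤ), IsHaggSeq σ ∧ IsHaggSeq σ' ∧
      (fun p => A₁ p + t₁) '' fccStacking 1 (Real.sqrt (2 / 3)) ⊆
        (fun p => L' p + s₁) '' barlowStacking 1 (Real.sqrt (2 / 3)) σ ∧
      (fun p => A₂ p + t₂) '' fccStacking 1 (Real.sqrt (2 / 3)) ⊆
        (fun p => L' p + s₂) '' barlowStacking 1 (Real.sqrt (2 / 3)) σ') :
    ∃ (L' : EuclideanSpace ℝ (Fin 3) ≃ₗᵢ[ℝ] EuclideanSpace ℝ (Fin 3))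
      (s₁ s₂ : EuclideanSpace ℝ (Fin 3)) (σ σ' : ℤ → ℤ), IsHaggSeq σ ∧ IsHaggSeq σ' ∧
      (fun p => A₁ p + t₁') '' fccStacking 1 (Real.sqrt (2 / 3)) ⊆
        (fun p => L' p + s₁) '' barlowStacking 1 (Real.sqrt (2 / 3)) σ ∧
      (fun p => A₂ p + t₂') '' fccStacking 1 (Real.sqrt (2 / 3)) ⊆
        (fun p => L' p + s₂) '' barlowStacking 1 (Real.sqrt (2 / 3)) σ' :=
  (coaxial_iff_common_frame A₁ A₂ t₁' t₂').2 ((coaxial_iff_common_frame A₁ A₂ t₁ t₂).1 h)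

/-- **A co-axial pair of different linear lattices is a mirror-twin pair in the common frame.** -/
theorem twin_of_coaxial_of_ne
    (A₁ A₂ : EuclideanSpace ℝ (Fin 3) ≃ₗᵢ[ℝ] EuclideanSpace ℝ (Fin 3)) (t₁ t₂ : EuclideanSpace ℝ (Fin 3))
    (h : ∃ (L' : EuclideanSpace ℝ (Fin 3) ≃ₗᵢ[ℝ] EuclideanSpace ℝ (Fin 3))
      (s₁ s₂ : EuclideanSpace ℝ (Fin 3)) (σ σ' : ℤ → ℤ), IsHaggSeq σ ∧ IsHaggSeq σ' ∧
      (fun p => A₁ p + t₁) '' fccStacking 1 (Real.sqrt (2 / 3)) ⊆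
        (fun p => L' p + s₁) '' barlowStacking 1 (Real.sqrt (2 / 3)) σ ∧
      (fun p => A₂ p + t₂) '' fccStacking 1 (Real.sqrt (2 / 3)) ⊆
        (fun p => L' p + s₂) '' barlowStacking 1 (Real.sqrt (2 / 3)) σ')
    (hne : A₁ '' fccStacking 1 (Real.sqrt (2 / 3)) ≠ A₂ '' fccStacking 1 (Real.sqrt (2 / 3))) :
    ∃ L : EuclideanSpace ℝ (Fin 3) ≃ₗᵢ[ℝ] EuclideanSpace ℝ (Fin 3),
      (A₁ '' fccStacking 1 (Real.sqrt (2 / 3)) = L '' fccStacking 1 (Real.sqrt (2 / 3)) ∧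
        A₂ '' fccStacking 1 (Real.sqrt (2 / 3)) =
          L '' barlowStacking 1 (Real.sqrt (2 / 3)) (fun _ : ℤ => (-1 : ℤ))) ∨
      (A₁ '' fccStacking 1 (Real.sqrt (2 / 3)) =
          L '' barlowStacking 1 (Real.sqrt (2 / 3)) (fun _ : ℤ => (-1 : ℤ)) ∧
        A₂ '' fccStacking 1 (Real.sqrt (2 / 3)) = L '' fccStacking 1 (Real.sqrt (2 / 3))) := by
  obtain ⟨L, h₁, h₂⟩ := (coaxial_iff_common_frame A₁ A₂ t₁ t₂).1 h
  refine ⟨L, ?_⟩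
  rcases h₁ with h₁ | h₁ <;> rcases h₂ with h₂ | h₂
  · exact absurd (h₁.trans h₂.symm) hne
  · exact Or.inl ⟨h₁, h₂⟩
  · exact Or.inr ⟨h₁, h₂⟩
  · exact absurd (h₁.trans h₂.symm) hne

end Summit.Ventures.Crystal3D.Theorems

end
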